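import Literature.Analysis.Calculus.ConePoincareHomotopy
import Literature.Analysis.Calculus.ConePeriodLinear
import Mathlib.MeasureTheory.Constructions.Pi
import Mathlib.MeasureTheory.Integral.Prod
import Mathlib.Analysis.Calculus.Deriv.Shift
import HarnessLib

/-!
# Cone periods of cone primitives: `∫_{[x₀,…,x_m]} h_b θ = ∫_{[b, x₀, …, x_m]} θ`

The link between the cone homotopy operator `h_b = conePrimitive b` of
`ConePoincareHomotopy.lean` and the cone periods `conePeriod` of `ConeCube.lean` (Dupont's
integration over straight simplices): for an `(m+1)`-form `θ` continuous on a convex set `X`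
containing `b, x₀, …, x_m`,

  `conePeriod m (conePrimitive b θ) x = conePeriod (m + 1) θ (Fin.cons b x)`    (`conePeriod_conePrimitive`).

Indeed the cone-cube of `(b, x₀, …, x_m)` is the cone over the cone-cube of `(x₀, …, x_m)`:
`κ(b, x)(s, t) = b + s (κ(x)(t) - b) = conePt b (κ x t) s` (`coneCube_cons`), with tangent vectors
`∂₀ = κ(x)(t) - b` and `∂_{j+1} = s ∂ⱼκ(x)(t)` (`fderiv_coneCube_cons_single_zero/succ`), so the
integrand of the left period is `s^m θ(conePt b z s)(z - b, ∂κ(x)(t))`, `z = κ x t`, and Fubini on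
`[0,1] × [0,1]^m` (`setIntegral_Icc_cons`) followed by the evaluation formula `conePrimitive_apply`
gives the right-hand side.  Iterating, compositions of cone operators with successive base points
evaluate to cone periods — the identity that matches the van Est / Čech–de Rham descent of a closed
equivariant form with Dupont's cone cocycle (`TwistedQuotientConeClass`).

Theorems only, no `sorry`. [cite: Dupont1976, §1–2] [cite: Spivak1965, Thm. 4-11]

## References

* J. L. Dupont, Topology 15 (1976), §1–2 (integration over straight simplices). [Dupont1976]
* M. Spivak, *Calculus on Manifolds* (1965), Thm. 4-11, Thm. 3-10 (Fubini). [Spivak1965]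
-/

noncomputable section

open Set MeasureTheory intervalIntegral Filter Topology
open scoped Interval

namespace Literature.Analysis.Calculus

variable {E F : Type*} [NormedAddCommGroup E] [NormedSpace ℝ E] [NormedAddCommGroup F] [NormedSpace ℝ F]
  {m : ℕ}

/-! ### The derivative of the cone over a cone-cube -/

variable (m) in
/-- `Fin.tail` as a continuous linear map `ℝ^{m+1} → ℝ^m`. [folklore] -/
def tailCLM : (Fin (m + 1) → ℝ) →L[ℝ] (Fin m → ℝ) :=
  ContinuousLinearMap.pi fun j => ContinuousLinearMap.proj j.succ

omit [NormedAddCommGroup E] [NormedSpace ℝ E] in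
/-- Unfolding. [folklore] -/
@[simp] theorem tailCLM_apply (u : Fin (m + 1) → ℝ) : tailCLM m u = Fin.tail u := rfl

variable (m) in
/-- The first coordinate `u ↦ u 0` as a continuous linear map `ℝ^{m+1} → ℝ`. [folklore] -/
def headCLM : (Fin (m + 1) → ℝ) →L[ℝ] ℝ :=
  ContinuousLinearMap.proj (R := ℝ) (φ := fun _ : Fin (m + 1) => ℝ) 0

omit [NormedAddCommGroup E] [NormedSpace ℝ E] in
/-- Unfolding. [folklore] -/
@[simp] theorem headCLM_apply (u : Fin (m + 1) → ℝ) : headCLM m u = u 0 := rfl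

omit [NormedAddCommGroup E] [NormedSpace ℝ E] in
/-- The basis vector `e₀` has no tail. [folklore] -/
theorem tail_single_zero : Fin.tail (Pi.single (0 : Fin (m + 1)) (1 : ℝ) : Fin (m + 1) → ℝ) = 0 := by
  funext j
  simp [Fin.tail, Fin.succ_ne_zero]

omit [NormedAddCommGroup E] [NormedSpace ℝ E] in
/-- The tail of `e_{j+1}` is `e_j`. [folklore] -/
theorem tail_single_succ (j : Fin m) : Fin.tail (Pi.single j.succ (1 : ℝ) : Fin (m + 1) → ℝ) = Pi.single j 1 := by
  funext i
  simp [Fin.tail, Pi.single_apply, Fin.succ_inj]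

/-- The cone-cube of `(b, x)` as a function of all parameters:
`κ(b,x)(u) = (1 - u₀) b + u₀ κ(x)(tail u)`. [folklore] -/
theorem coneCube_cons_eq (b : E) (x : Fin (m + 1) → E) (u : Fin (m + 1) → ℝ) :
    coneCube (m + 1) (Fin.cons b x) u = (1 - u 0) • b + (u 0) • coneCube m x (Fin.tail u) := by
  rw [coneCube_succ]
  simp only [Fin.cons_zero, Fin.cons_succ]
  rfl

/-- **The derivative of `κ(b, x)`**: `Dκ(b,x)(u) w = -w₀ b + w₀ κ(x)(tail u) + u₀ Dκ(x)(tail u)(tail w)`.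
[folklore] -/
theorem hasFDerivAt_coneCube_cons (b : E) (x : Fin (m + 1) → E) (u : Fin (m + 1) → ℝ) :
    HasFDerivAt (coneCube (m + 1) (Fin.cons b x))
      (((0 : (Fin (m + 1) → ℝ) →L[ℝ] ℝ) - headCLM m).smulRight b +
        ((u 0) • (fderiv ℝ (coneCube m x) (Fin.tail u)).comp (tailCLM m) +
          (headCLM m).smulRight (coneCube m x (Fin.tail u)))) u := by
  have hfun : coneCube (m + 1) (Fin.cons b x) =
      fun u : Fin (m + 1) → ℝ => (1 - u 0) • b + (u 0) • coneCube m x (Fin.tail u) :=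
    funext fun u => coneCube_cons_eq b x u
  rw [hfun]
  have h0 : HasFDerivAt (fun u : Fin (m + 1) → ℝ => u 0) (headCLM m) u := (headCLM m).hasFDerivAt
  have h1 : HasFDerivAt (fun u : Fin (m + 1) → ℝ => (1 : ℝ) - u 0) ((0 : (Fin (m + 1) → ℝ) →L[ℝ] ℝ) - headCLM m) u :=
    (hasFDerivAt_const (1 : ℝ) u).sub h0
  have htail : HasFDerivAt (fun u : Fin (m + 1) → ℝ => Fin.tail u) (tailCLM m) u := (tailCLM m).hasFDerivAt
  have hκ : HasFDerivAt (fun u : Fin (m + 1) → ℝ => coneCube m x (Fin.tail u))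
      ((fderiv ℝ (coneCube m x) (Fin.tail u)).comp (tailCLM m)) u :=
    HasFDerivAt.comp u ((differentiable_coneCube m x _).hasFDerivAt) htail
  exact (h1.smul_const b).add (h0.smul hκ)

omit [NormedAddCommGroup E] [NormedSpace ℝ E] in
/-- Moving along `e₀` from `(s, t)` changes `s` only. [folklore] -/
theorem cons_add_smul_single_zero (s r : ℝ) (t : Fin m → ℝ) :
    (Fin.cons s t : Fin (m + 1) → ℝ) + r • Pi.single (0 : Fin (m + 1)) (1 : ℝ) = Fin.cons (s + r) t := by
  funext i
  refine Fin.cases ?_ (fun j => ?_) i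
  · simp
  · simp [Fin.succ_ne_zero]

omit [NormedAddCommGroup E] [NormedSpace ℝ E] in
/-- Moving along `e_{j+1}` from `(s, t)` changes `t` only, along `e_j`. [folklore] -/
theorem cons_add_smul_single_succ (s r : ℝ) (t : Fin m → ℝ) (j : Fin m) :
    (Fin.cons s t : Fin (m + 1) → ℝ) + r • Pi.single j.succ (1 : ℝ) =
      (Fin.cons s (t + r • (Pi.single j (1 : ℝ) : Fin m → ℝ)) : Fin (m + 1) → ℝ) := by
  funext i
  refine Fin.cases ?_ (fun k => ?_) i
  · simp [(Fin.succ_ne_zero j).symm]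
  · simp [Pi.single_apply, Fin.succ_inj]

/-- The point of the cone over the cone-cube: `κ(b, x)(s, t) = conePt b (κ x t) s`. [folklore] -/
theorem coneCube_cons_eq_conePt (b : E) (x : Fin (m + 1) → E) (s : ℝ) (t : Fin m → ℝ) :
    coneCube (m + 1) (Fin.cons b x) (Fin.cons s t) = conePt b (coneCube m x t) s := by
  rw [coneCube_cons_eq, Fin.cons_zero, Fin.tail_cons, conePt, smul_sub, sub_smul, one_smul]
  abel

/-- **`∂₀ κ(b, x)(s, t) = κ(x)(t) - b`.** [cite: Dupont1976, §1] -/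
theorem fderiv_coneCube_cons_single_zero (b : E) (x : Fin (m + 1) → E) (s : ℝ) (t : Fin m → ℝ) :
    fderiv ℝ (coneCube (m + 1) (Fin.cons b x)) (Fin.cons s t) (Pi.single (0 : Fin (m + 1)) (1 : ℝ)) =
      coneCube m x t - b := by
  rw [fderiv_apply_eq_deriv_line (differentiable_coneCube (m + 1) _)]
  have hfun : (fun r : ℝ => coneCube (m + 1) (Fin.cons b x) ((Fin.cons s t : Fin (m + 1) → ℝ) + r • Pi.single 0 1)) =
      fun r : ℝ => conePt b (coneCube m x t) (s + r) := by
    funext r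
    rw [cons_add_smul_single_zero, coneCube_cons_eq_conePt]
  rw [hfun]
  have h : HasDerivAt (fun r : ℝ => conePt b (coneCube m x t) (s + r)) (coneCube m x t - b) 0 :=
    HasDerivAt.comp_const_add s 0 (hasDerivAt_conePt b (coneCube m x t) (s + 0))
  exact h.deriv

/-- **`∂_{j+1} κ(b, x)(s, t) = s ∂ⱼ κ(x)(t)`.** [cite: Dupont1976, §1] -/
theorem fderiv_coneCube_cons_single_succ (b : E) (x : Fin (m + 1) → E) (s : ℝ) (t : Fin m → ℝ) (j : Fin m) :
    fderiv ℝ (coneCube (m + 1) (Fin.cons b x)) (Fin.cons s t) (Pi.single j.succ (1 : ℝ)) =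
      s • fderiv ℝ (coneCube m x) t (Pi.single j (1 : ℝ)) := by
  rw [fderiv_apply_eq_deriv_line (differentiable_coneCube (m + 1) _),
    fderiv_apply_eq_deriv_line (differentiable_coneCube m x)]
  have hfun : (fun r : ℝ => coneCube (m + 1) (Fin.cons b x) ((Fin.cons s t : Fin (m + 1) → ℝ) + r • Pi.single j.succ 1)) =
      fun r : ℝ => conePt b (coneCube m x (t + r • (Pi.single j (1 : ℝ) : Fin m → ℝ))) s := by
    funext r
    rw [cons_add_smul_single_succ, coneCube_cons_eq_conePt]
  rw [hfun]
  -- the inner curve `r ↦ κ x (t + r e_j)` is differentiable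
  have hγ : HasDerivAt (fun r : ℝ => t + r • Pi.single j (1 : ℝ)) (Pi.single j (1 : ℝ)) 0 := by
    simpa using ((hasDerivAt_id (0 : ℝ)).smul_const (Pi.single j (1 : ℝ))).const_add t
  have hinner : HasDerivAt (fun r : ℝ => coneCube m x (t + r • Pi.single j 1))
      (deriv (fun r : ℝ => coneCube m x (t + r • Pi.single j 1)) 0) 0 := by
    have hd : DifferentiableAt ℝ (fun r : ℝ => coneCube m x (t + r • Pi.single j 1)) 0 :=
      ((differentiable_coneCube m x) _).comp (𝕜 := ℝ) 0 hγ.differentiableAt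
    exact hd.hasDerivAt
  -- `conePt b · s` is affine with linear part `s • id`
  have h : HasDerivAt (fun r : ℝ => conePt b (coneCube m x (t + r • Pi.single j 1)) s)
      (s • deriv (fun r : ℝ => coneCube m x (t + r • Pi.single j 1)) 0) 0 := by
    have h1 := ((hinner.sub_const b).const_smul s).const_add b
    simpa [conePt] using h1
  exact h.deriv

/-! ### Scaling all but the first argument -/

omit [NormedAddCommGroup E] [NormedSpace ℝ E] in
/-- Scaling all but the first entry, written with a scalar vector. [folklore] -/
private theorem vecCons_smul_eq {G : Type*} [AddCommGroup G] [Module ℝ G] (u : G) (s : ℝ) (D : Fin m → G) :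
    Matrix.vecCons u (fun j => s • D j) = fun i => Matrix.vecCons (1 : ℝ) (fun _ : Fin m => s) i • Matrix.vecCons u D i := by
  funext i
  refine Fin.cases ?_ (fun j => ?_) i
  · simp
  · simp

/-- `f(u, s D₁, …, s D_m) = s^m f(u, D₁, …, D_m)` for a multilinear `f`. [folklore] -/
theorem map_vecCons_smul (f : E [⋀^Fin (m + 1)]→L[ℝ] F) (u : E) (s : ℝ) (D : Fin m → E) :
    f (Matrix.vecCons u (fun j => s • D j)) = s ^ m • f (Matrix.vecCons u D) := by
  rw [vecCons_smul_eq u s D]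
  have h := f.toContinuousMultilinearMap.map_smul_univ (Matrix.vecCons (1 : ℝ) (fun _ : Fin m => s)) (Matrix.vecCons u D)
  rw [Fin.prod_univ_succ] at h
  simp only [Matrix.cons_val_zero, Matrix.cons_val_succ, Finset.prod_const, Finset.card_univ, Fintype.card_fin,
    one_mul] at h
  exact h

/-! ### Fubini on the cube: the first parameter separated -/

omit [NormedAddCommGroup E] [NormedSpace ℝ E] in
/-- **Fubini on `[0,1]^{m+1} = [0,1] × [0,1]^m`** for an integrable function, the first coordinate
integrated INSIDE (`Fin.cons`). [cite: Spivak1965, Thm. 3-10] -/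
theorem setIntegral_Icc_cons [CompleteSpace F] {f : (Fin (m + 1) → ℝ) → F} (hf : IntegrableOn f (Icc 0 1)) :
    ∫ u in Icc (0 : Fin (m + 1) → ℝ) 1, f u =
      ∫ t in Icc (0 : Fin m → ℝ) 1, ∫ s in Icc (0 : ℝ) 1, f (Fin.cons s t) := by
  set e : ℝ × (Fin m → ℝ) ≃ᵐ (Fin (m + 1) → ℝ) := (MeasurableEquiv.piFinSuccAbove (fun _ => ℝ) 0).symm with he
  have hem : MeasurePreserving e :=
    (volume_preserving_piFinSuccAbove (fun _ : Fin (m + 1) => ℝ) 0).symm _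
  have he_apply : ∀ (s : ℝ) (t : Fin m → ℝ), e (s, t) = Fin.cons s t := by
    intro s t
    rw [he, MeasurableEquiv.piFinSuccAbove_symm_apply, Fin.insertNthEquiv, Equiv.coe_fn_mk]
    exact Fin.insertNth_zero' s t
  have heπ : e ⁻¹' Icc (0 : Fin (m + 1) → ℝ) 1 = Icc (0 : ℝ) 1 ×ˢ Icc (0 : Fin m → ℝ) 1 := by
    ext ⟨s, t⟩
    simp only [mem_preimage, he_apply, mem_Icc, mem_prod, Pi.le_def, Fin.forall_fin_succ, Fin.cons_zero,
      Fin.cons_succ, Pi.zero_apply, Pi.one_apply]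
    tauto
  have hint : IntegrableOn (fun p : ℝ × (Fin m → ℝ) => f (e p)) (Icc (0 : ℝ) 1 ×ˢ Icc (0 : Fin m → ℝ) 1)
      (volume.prod volume) := by
    have h := hf
    rw [← hem.integrableOn_comp_preimage e.measurableEmbedding, heπ, Measure.volume_eq_prod] at h
    exact h
  rw [← hem.map_eq, setIntegral_map_equiv, heπ, Measure.volume_eq_prod]
  change ∫ p in Icc (0 : ℝ) 1 ×ˢ Icc (0 : Fin m → ℝ) 1, f (e p) ∂(volume.prod volume) = _
  rw [← Measure.prod_restrict, integral_prod_symm _ (by rwa [Measure.prod_restrict])]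
  refine integral_congr_ae (Filter.Eventually.of_forall fun t => ?_)
  refine integral_congr_ae (Filter.Eventually.of_forall fun s => ?_)
  simp only [he_apply]

/-! ### Cone periods of cone primitives -/

/-- **The integrand of `∫_{[b, x]} θ` is `s^m θ(conePt b z s)(z - b, ∂κ(x)(t))`, `z = κ x t`.**
[cite: Dupont1976, §1–2] -/
theorem conePeriodIntegrand_cons (θ : E → E [⋀^Fin (m + 1)]→L[ℝ] F) (b : E) (x : Fin (m + 1) → E)
    (s : ℝ) (t : Fin m → ℝ) :
    θ (coneCube (m + 1) (Fin.cons b x) (Fin.cons s t))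
        (fun j => fderiv ℝ (coneCube (m + 1) (Fin.cons b x)) (Fin.cons s t) (Pi.single j (1 : ℝ))) =
      s ^ m • θ (conePt b (coneCube m x t) s)
        (Matrix.vecCons (coneCube m x t - b) fun j => fderiv ℝ (coneCube m x) t (Pi.single j (1 : ℝ))) := by
  rw [coneCube_cons_eq_conePt, ← map_vecCons_smul]
  congr 1
  funext j
  refine Fin.cases ?_ (fun i => ?_) j
  · rw [Matrix.cons_val_zero, fderiv_coneCube_cons_single_zero]
  · rw [Matrix.cons_val_succ, fderiv_coneCube_cons_single_succ]

/-- **Cone periods of cone primitives**: for an `(m+1)`-form `θ` continuous on a convex set `X`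
containing `b, x₀, …, x_m`, `∫_{[x₀,…,x_m]} h_b θ = ∫_{[b, x₀, …, x_m]} θ`, i.e.
`conePeriod m (conePrimitive b θ) x = conePeriod (m + 1) θ (Fin.cons b x)` (Fubini on
`[0,1] × [0,1]^m` and the evaluation formula of the cone operator). [cite: Dupont1976, §1–2] -/
theorem conePeriod_conePrimitive [CompleteSpace F] {X : Set E} (hXc : Convex ℝ X)
    {θ : E → E [⋀^Fin (m + 1)]→L[ℝ] F} (hθ : ContinuousOn θ X) {b : E} (hb : b ∈ X)
    {x : Fin (m + 1) → E} (hx : ∀ i, x i ∈ X) :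
    conePeriod m (conePrimitive b θ) x = conePeriod (m + 1) θ (Fin.cons b x) := by
  have hbx : ∀ i, (Fin.cons b x : Fin (m + 2) → E) i ∈ X := fun i => Fin.cases hb hx i
  have hXb : StarConvex ℝ b X := hXc.starConvex hb
  rw [conePeriod_def (m + 1), setIntegral_Icc_cons (integrableOn_conePeriodIntegrand hXc (m + 1) hθ hbx),
    conePeriod_def]
  refine setIntegral_congr_fun measurableSet_Icc fun t ht => ?_
  have hz : coneCube m x t ∈ X := coneCube_mem_of_convex hXc m hx fun j => ⟨ht.1 j, ht.2 j⟩
  rw [conePrimitive_apply hθ hXb hz, intervalIntegral.integral_of_le zero_le_one,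
    Measure.restrict_congr_set Ioc_ae_eq_Icc]
  refine setIntegral_congr_fun measurableSet_Icc fun s _ => ?_
  exact (conePeriodIntegrand_cons θ b x s t).symm

end Literature.Analysis.Calculus

end
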